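import Literature.Probability.RandomPlanarGeometry.YangBaxterSAWUnwoundPlaquette
import Literature.Probability.RandomPlanarGeometry.YangBaxterSAWYBE
import HarnessLib

/-!
# The Glazman–Manolescu weights as a TRIANGLE: `v² = u₁² + w₁² − 2u₁w₁·cos(3θ/8) = u₂² + w₂² − 2u₂w₂·cos(3π/8 − 3θ/8)`

Companion of `YangBaxterSAWUnwoundPlaquette` (this topic: the identities `w₁ = u₁(cos(3θ/8) − sin(3θ/8))`,
`v = √2·u₁·sin(3θ/8)` between the weights of [GlazmanManolescu2019, eq. (1)], used there for the twelve closed forms of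
the backward half-bracket) and of the barrier catalogue's `PlaquetteWalkRootPlaquetteDefectLaw` (Lemma E: every
backward half-bracket has modulus `v(θ)`, by a 24-case computation).

This file records the two identities behind Lemma E in their geometric form: the straight-arc weight `v(θ)` is the
third side of the triangle with sides `u₁(θ)`, `w₁(θ)` and enclosed angle `3θ/8`, and of the triangle with sides
`u₂(θ)`, `w₂(θ)` and enclosed angle `3π/8 − 3θ/8` (the mirror `θ ↦ π − θ`):

* ★ `weightV_sq_eq_corner`   : `v(θ)² = u₁(θ)² + w₁(θ)² − 2·u₁(θ)·w₁(θ)·cos(3θ/8)` (all real `θ`);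
* ★ `weightV_sq_eq_coCorner` : `v(θ)² = u₂(θ)² + w₂(θ)² − 2·u₂(θ)·w₂(θ)·cos(3π/8 − 3θ/8)` (all real `θ`);
* `normSq_weightU1_sub_weightW1_mul_cexp`, `norm_weightU1_sub_weightW1_mul_cexp` (`‖u₁ − w₁·e^{±i·3θ/8}‖ = |v(θ)|`),
  `normSq_weightU2_sub_weightW2_mul_cexp` — the form in which Lemma E uses them: a
  backward half-bracket on a corner pair `{z₀, z₂}` is, up to a unit, `u₁ − w₁·e^{±3iθ/8}` (coefficient ratio
  `c(z₁)c̄(z₃)·e^{i(5/8)arcTurn(z₁,z₃)} = −e^{±3iθ/8}`), on a co-corner pair `u₂ − w₂·e^{±i(3π/8 − 3θ/8)}`, and on a straight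
  pair `±c·v` itself.

Elementary trigonometry on eq. (1); no claim beyond the identities. (Venture lane «pcv-sawmu»: the same two identities in
the form `u₂·w₁ = v·(αu₁ − βu₂)`, `u₁·w₂ = v·(αu₂ − βu₁)`, `α = 1/(√2·cos(π/8))`, `β = tan(π/8)`, cut out the printed one-
parameter family of weights together with `v²(…) = 2u₁²u₂²`; not used here.) [cite: GlazmanManolescu2019, §1, eq. (1)]
-/

noncomputable section

namespace Literature.Probability.RandomPlanarGeometry.SAW.YangBaxter

open Real

/-- ★ **The straight weight is the third side of the `(u₁, w₁)` triangle with enclosed angle `3θ/8`**: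
`v² = u₁² + w₁² − 2u₁w₁cos(3θ/8)`. [cite: GlazmanManolescu2019, §1, eq. (1)] -/
theorem weightV_sq_eq_corner (θ : ℝ) :
    weightV θ ^ 2 = weightU1 θ ^ 2 + weightW1 θ ^ 2 - 2 * weightU1 θ * weightW1 θ * Real.cos (3 * θ / 8) := by
  rw [weightW1_eq_weightU1_mul, weightV_eq_sqrt_two_mul]
  have h2 : Real.sqrt 2 ^ 2 = 2 := Real.sq_sqrt (by norm_num)
  have hsc := Real.sin_sq_add_cos_sq (3 * θ / 8)
  linear_combination (weightU1 θ ^ 2 * Real.sin (3 * θ / 8) ^ 2) * h2 + weightU1 θ ^ 2 * hsc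

/-- ★ **The mirror triangle**: `v² = u₂² + w₂² − 2u₂w₂cos(3π/8 − 3θ/8)` (the remark after eq. (1): `θ ↦ π − θ` exchanges
`u₁ ↔ u₂`, `w₁ ↔ w₂` and fixes `v`). [cite: GlazmanManolescu2019, §1, eq. (1) and the remark after it] -/
theorem weightV_sq_eq_coCorner (θ : ℝ) :
    weightV θ ^ 2 = weightU2 θ ^ 2 + weightW2 θ ^ 2 - 2 * weightU2 θ * weightW2 θ * Real.cos (3 * π / 8 - 3 * θ / 8) := by
  have h := weightV_sq_eq_corner (π - θ)
  rw [weightV_pi_sub, weightU1_pi_sub, weightW1_pi_sub] at h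
  rw [h, show 3 * (π - θ) / 8 = 3 * π / 8 - 3 * θ / 8 by ring]

/-- `e^{iy} = cos y + i·sin y` with real casts. [folklore] -/
private theorem cexp_real_mul_I_T (y : ℝ) :
    Complex.exp ((y : ℂ) * Complex.I) = (Real.cos y : ℂ) + (Real.sin y : ℂ) * Complex.I := by
  rw [Complex.exp_mul_I, ← Complex.ofReal_cos, ← Complex.ofReal_sin]

/-- The complex form used by Lemma E: `‖u₁ − w₁·e^{i·y}‖² = v²` for `y = ±3θ/8` (any `y` with `cos y = cos(3θ/8)`).
[cite: GlazmanManolescu2019, §1, eq. (1)] -/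
theorem normSq_weightU1_sub_weightW1_mul_cexp (θ y : ℝ) (hy : Real.cos y = Real.cos (3 * θ / 8)) :
    Complex.normSq ((weightU1 θ : ℂ) - (weightW1 θ : ℂ) * Complex.exp ((y : ℂ) * Complex.I)) = weightV θ ^ 2 := by
  have e : (weightU1 θ : ℂ) - (weightW1 θ : ℂ) * Complex.exp ((y : ℂ) * Complex.I) =
      ((weightU1 θ - weightW1 θ * Real.cos y : ℝ) : ℂ) + ((-(weightW1 θ * Real.sin y) : ℝ) : ℂ) * Complex.I := by
    rw [cexp_real_mul_I_T]; push_cast; ring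
  rw [e, Complex.normSq_add_mul_I, weightV_sq_eq_corner, ← hy]
  have hsc := Real.sin_sq_add_cos_sq y
  linear_combination (weightW1 θ ^ 2) * hsc

/-- `‖u₁ − w₁·e^{±i·3θ/8}‖ = |v(θ)|`. [cite: GlazmanManolescu2019, §1, eq. (1)] -/
theorem norm_weightU1_sub_weightW1_mul_cexp (θ : ℝ) (ε : ℝ) (hε : ε = 1 ∨ ε = -1) :
    ‖(weightU1 θ : ℂ) - (weightW1 θ : ℂ) * Complex.exp (((ε * (3 * θ / 8) : ℝ) : ℂ) * Complex.I)‖ = |weightV θ| := by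
  have hy : Real.cos (ε * (3 * θ / 8)) = Real.cos (3 * θ / 8) := by
    rcases hε with rfl | rfl
    · rw [one_mul]
    · rw [neg_one_mul, Real.cos_neg]
  have h := normSq_weightU1_sub_weightW1_mul_cexp θ (ε * (3 * θ / 8)) hy
  rw [Complex.normSq_eq_norm_sq] at h
  have hn : 0 ≤ ‖(weightU1 θ : ℂ) - (weightW1 θ : ℂ) * Complex.exp (((ε * (3 * θ / 8) : ℝ) : ℂ) * Complex.I)‖ :=
    norm_nonneg _
  rw [← Real.sqrt_sq hn, h, Real.sqrt_sq_eq_abs]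

/-- The mirror form: `‖u₂ − w₂·e^{i·y}‖² = v²` for any `y` with `cos y = cos(3π/8 − 3θ/8)`. [cite: GlazmanManolescu2019, §1, eq. (1) and the remark after it] -/
theorem normSq_weightU2_sub_weightW2_mul_cexp (θ y : ℝ) (hy : Real.cos y = Real.cos (3 * π / 8 - 3 * θ / 8)) :
    Complex.normSq ((weightU2 θ : ℂ) - (weightW2 θ : ℂ) * Complex.exp ((y : ℂ) * Complex.I)) = weightV θ ^ 2 := by
  have e : (weightU2 θ : ℂ) - (weightW2 θ : ℂ) * Complex.exp ((y : ℂ) * Complex.I) =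
      ((weightU2 θ - weightW2 θ * Real.cos y : ℝ) : ℂ) + ((-(weightW2 θ * Real.sin y) : ℝ) : ℂ) * Complex.I := by
    rw [cexp_real_mul_I_T]; push_cast; ring
  rw [e, Complex.normSq_add_mul_I, weightV_sq_eq_coCorner, ← hy]
  have hsc := Real.sin_sq_add_cos_sq y
  linear_combination (weightW2 θ ^ 2) * hsc

end Literature.Probability.RandomPlanarGeometry.SAW.YangBaxter
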